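import Literature.MathematicalPhysics.QuantumFieldTheory.Balaban1983to89.T4ExpWindowSmallField
import HarnessLib

/-!
# Crux `FluctuationComparisonRegPrIntL` (stmt-QuantumFields-20520, rung R3), PATH-B organ — «THE COMMUTATOR SHADOW OF THE SEED CLAUSE» (TN-GRAD-W, LEAD w3 g27;
# DEFINITION-FREE): two instances of the scaled one-bond-pair clause `HClauseSq θ r k R` on the SAME bond with the two moves in either order bound the change of `R` under
# the ORDER SWAP `U·e^{v}e^{v′}@b ↦ U·e^{v′}e^{v}@b` — a group-COMMUTATOR displacement — by `2·k b b·(‖v‖∕θ)(‖v′‖∕θ)`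

Cell `ym3-torus` (YM ladder rung R3 = continuum `SU(2)` Yang–Mills on the three-torus — a RUNG: NOT d = 4, NOT infinite volume, NOT a mass gap, NOT Clay).
Width seat `ym-ust-20520-w3` (gen 27, LEAD-20520 organ-tangent lane); `--kind proof --supports stmt-QuantumFields-20520 --as helper`, count-neutral, no registry ∕ binder ∕
`Lines/` edit, default heartbeats, `autoImplicit false`.  The clause is spelled out (its `Lines/runpair_organ.lean` `HClauseSq` text = ✓p797413 `firstDiff_window_path`'s
hypothesis), so nothing under `Cruxes/` is imported.

WHY (TN-GRAD-W).  In the organ rows the (I-curv) mass tie `Σ_{B′} (Σ_{pq} KP·k̃·KP + Σ_p gP·KP2 + ES·kB)·e^{κ·tdist} ≤ NT·(D_j∕D_Ts)·w + δT_j·D_j` must hold for EVERY seed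
`(k, w)` for which the seed clause holds; its right side is proportional to the seed budget `w` (the `δT` slack is volume-small), so the GRADIENT slot `gP` (the `Σ_p ∂_p h·∂²Φ_p` term
of the (s2) curvature square clause) must itself be `O(seed)` — the frame's analyticity bound `Bρ` (w-independent) cannot pay for it.  On a NON-ABELIAN group the seed clause DOES
control first derivatives: the order swap of two moves on one bond is right multiplication by a group commutator, commutators of moves of size `ρ` fill a ball of radius `≍ ρ²`
(`[v, v′]` spans `su(2)`), and the present lemma bounds `R`'s change under every such swap by the DIAGONAL letter `k b b` — the finite-difference shadow of
`|D R(U)[U·[v,v′]]| ≤ 2·k b b·‖v‖‖v′‖∕θ²` (the two mixed partials of `(s,t) ↦ R(U·e^{sv}e^{tv′})` and `R(U·e^{tv′}e^{sv})` differ by exactly the commutator derivative).  In an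
ABELIAN toy the left side vanishes identically — the slot is invisible to linearised prices.  What the lemma does NOT do: turn the shadow into a pointwise gradient letter (needs
joint `C²` of `R` in one link variable — (P1)-currency — and the local surjectivity of the commutator map), nor price `Σ_p KP2` (instrument∕LOCATE work).

WHAT.  ★`abs_sub_swap_le_of_hClauseSq`: the clause (hypothesis, spelled out) at `(b, b, v, v′)` and `(b, b, v′, v)` ⟹ `|R Z − R Z′| ≤ 2·(k b b·(‖v‖∕θ)·(‖v′‖∕θ))` for the
relational configurations `V = U·e^{v}@b`, `W = U·e^{v′}@b`, `Z = V·e^{v′}@b`, `Z′ = W·e^{v}@b` (all five in the `θ`-window); `swap_configs_eq`: `Z b = U b·e^{v}·e^{v′}`,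
`Z′ b = U b·e^{v′}·e^{v}`, `Z = Z′` off `b`.

HONEST FRAMING: two instances of a HYPOTHESIS clause and a subtraction [folklore]; nothing of Bałaban's analysis is asserted or proved; the seed clause, the rows
`OrganDischargeInputsHJ(sq)` ∕ `SpreadFibreLawH(J)(sq)` are HYPOTHESES ∕ UNDISCHARGED; LIN″ ∕ JEN″ ∕ O1ᵘ-H v2.2 ∕ S1aᴴ ∕ S2β, the five registered stubs of `Lines/semiclassical_s2beta.lean`
(3732b7df, untouched), crux 20520 and `YM3TorusSU2` are NOT proved; rung R3 = SU(2) YM₃ on T³ at fixed lattice data — NOT d = 4, NOT infinite volume, NOT a mass gap, NOT Clay; the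
Yang–Mills mass gap is NOT proved.  [folklore]
-/

set_option autoImplicit false

noncomputable section

namespace Summit.QuantumFields.YangMills.Theorems.OrganTangentSeedCommutatorShadow

open Literature.MathematicalPhysics.QuantumFieldTheory.Balaban1983to89
open T4CubeChartExp (expPt)

variable {P : Params} {j : ℕ}

/-- ★ **THE COMMUTATOR SHADOW OF THE SEED CLAUSE** (TN-GRAD-W, LEAD w3 g27).  The scaled one-bond-pair clause `HClauseSq θ r k R`, instantiated TWICE on the SAME bond `b`
with the two moves `v`, `v′` in either order, bounds the change of `R` under the ORDER SWAP of the two moves — i.e. under right multiplication of the bond variable by the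
group commutator of `e^{v′}` and `e^{v}`: `|R(U·e^{v}e^{v′}@b) − R(U·e^{v′}e^{v}@b)| ≤ 2·k b b·(‖v‖∕θ)·(‖v′‖∕θ)`.  On a NON-ABELIAN group the commutators of moves of size `ρ`
fill a ball of radius `≍ ρ²`, so this is a FIRST-ORDER (gradient) bound for `R` paid by the DIAGONAL seed letter `k b b` — the rigidity that lets the (I-curv) gradient slot `gP`
be `O(seed budget)`; in an abelian toy the left side vanishes identically and the slot is invisible.  Pure bookkeeping: two instances of the clause and a subtraction. [folklore] -/
theorem abs_sub_swap_le_of_hClauseSq {θ r : ℝ} {k : PBond P j → PBond P j → ℝ}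
    {R : GaugeField P j ↥(Matrix.specialUnitaryGroup (Fin 2) ℂ) → ℝ}
    -- the `HClauseSq θ r k R` text of `Lines/runpair_organ.lean` (= ✓p797413 `firstDiff_window_path`'s hypothesis), spelled out
    (h : ∀ (b b' : PBond P j) (v v' : Fin 3 → ℝ) (U V W Z : GaugeField P j ↥(Matrix.specialUnitaryGroup (Fin 2) ℂ)),
      ‖v‖ ≤ r * θ → ‖v'‖ ≤ r * θ → PlaqSmall θ U → PlaqSmall θ V → PlaqSmall θ W → PlaqSmall θ Z →
      (∀ e, e ≠ b → V e = U e) → V b = U b * expPt v → (∀ e, e ≠ b' → W e = U e) → W b' = U b' * expPt v' →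
      (∀ e, e ≠ b' → Z e = V e) → Z b' = V b' * expPt v' →
      |R Z - R V - R W + R U| ≤ k b b' * (‖v‖ / θ) * (‖v'‖ / θ))
    (b : PBond P j) (v v' : Fin 3 → ℝ) (U V W Z Z' : GaugeField P j ↥(Matrix.specialUnitaryGroup (Fin 2) ℂ))
    (hv : ‖v‖ ≤ r * θ) (hv' : ‖v'‖ ≤ r * θ)
    (hU : PlaqSmall θ U) (hV : PlaqSmall θ V) (hW : PlaqSmall θ W) (hZ : PlaqSmall θ Z) (hZ' : PlaqSmall θ Z')
    (hVU : ∀ e, e ≠ b → V e = U e) (hVb : V b = U b * expPt v)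
    (hWU : ∀ e, e ≠ b → W e = U e) (hWb : W b = U b * expPt v')
    (hZV : ∀ e, e ≠ b → Z e = V e) (hZb : Z b = V b * expPt v')
    (hZ'W : ∀ e, e ≠ b → Z' e = W e) (hZ'b : Z' b = W b * expPt v) :
    |R Z - R Z'| ≤ 2 * (k b b * (‖v‖ / θ) * (‖v'‖ / θ)) := by
  -- the clause with `(v, v′)`: corners `U, V, W, Z`
  have h1 := h b b v v' U V W Z hv hv' hU hV hW hZ hVU hVb hWU hWb hZV hZb
  -- the clause with `(v′, v)`: corners `U, W, V, Z′`
  have h2 := h b b v' v U W V Z' hv' hv hU hW hV hZ' hWU hWb hVU hVb hZ'W hZ'b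
  have e : R Z - R Z' = (R Z - R V - R W + R U) - (R Z' - R W - R V + R U) := by ring
  rw [e]
  have hcomm : k b b * (‖v'‖ / θ) * (‖v‖ / θ) = k b b * (‖v‖ / θ) * (‖v'‖ / θ) := by ring
  rw [hcomm] at h2
  calc |(R Z - R V - R W + R U) - (R Z' - R W - R V + R U)|
      ≤ |R Z - R V - R W + R U| + |R Z' - R W - R V + R U| := abs_sub _ _
    _ ≤ k b b * (‖v‖ / θ) * (‖v'‖ / θ) + k b b * (‖v‖ / θ) * (‖v'‖ / θ) := add_le_add h1 h2
    _ = 2 * (k b b * (‖v‖ / θ) * (‖v'‖ / θ)) := by ring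

/-- The two end configurations of ★`abs_sub_swap_le_of_hClauseSq` in closed form: `Z b = U b·e^{v}·e^{v′}`, `Z′ b = U b·e^{v′}·e^{v}` (so `Z′ b = Z b·(e^{v′}⁻¹e^{v}⁻¹e^{v′}e^{v})`-type
commutator displacement), and `Z = Z′` off the bond `b`. [folklore] -/
theorem swap_configs_eq {b : PBond P j} {v v' : Fin 3 → ℝ} {U V W Z Z' : GaugeField P j ↥(Matrix.specialUnitaryGroup (Fin 2) ℂ)}
    (hVU : ∀ e, e ≠ b → V e = U e) (hVb : V b = U b * expPt v)
    (hWU : ∀ e, e ≠ b → W e = U e) (hWb : W b = U b * expPt v')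
    (hZV : ∀ e, e ≠ b → Z e = V e) (hZb : Z b = V b * expPt v')
    (hZ'W : ∀ e, e ≠ b → Z' e = W e) (hZ'b : Z' b = W b * expPt v) :
    Z b = U b * expPt v * expPt v' ∧ Z' b = U b * expPt v' * expPt v ∧ ∀ e, e ≠ b → Z e = Z' e := by
  refine ⟨by rw [hZb, hVb], by rw [hZ'b, hWb], fun e he => ?_⟩
  rw [hZV e he, hZ'W e he, hVU e he, hWU e he]

end Summit.QuantumFields.YangMills.Theorems.OrganTangentSeedCommutatorShadow

end
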